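import Summits.Schanuel.Schanuel.Theorems.MinimalCounterexampleInAcl.Negative.KhovanskiiPoint
import Summits.Schanuel.Schanuel.Theses.RootDecomp1F

/-!
# RootDecomp1F — support item `Presentable` (stmt-Schanuel-26229): a first failure is a non-degenerate Khovanskii point

The support binder `Presentable` of route-Schanuel-RootDecomp1F (lens-5 «KhovanskiiCells», cell decomp-schanuel):
a first failure of Schanuel's conjecture (ℚ-free `x ∈ ℂⁿ` with `trdeg ℚ(x, eˣ) < n` while `SchanuelRank` holds
below `n`) is a non-degenerate zero of a Khovanskii system of `n` ℚ-polynomials of some size `c`.  Proof =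
the landed Summits theorem `MinimalCounterexampleInAcl.Negative.firstFailure_khovanskii` (route RigidCore;
= `Literature.Barriers.Schanuel.firstFailure_exists_khovanskiiSystem`: Khovanskii dichotomy + Ax 1971 Thm 3 with
its rank term + tower law [cite: Kirby2010, Lemma 4.8 and Prop. 7.2] [cite: Ax1971, Thm. 3]) plus the size
bookkeeping `c := sup of the sizes of the gᵢ`.  (The lens-5 hand-off
`HOME/decomp-schanuel-lens-5/writer/inline/prover/RootDecomp1FPresentable.lean` carried a verbatim copy of the tree
theorem; the gate's dedup points to the landed twin, imported here instead.)  Census seat (prover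
role); this file defines nothing; 0 sorry.
-/

noncomputable section

set_option linter.dupNamespace false

namespace Summit.Schanuel.Schanuel.Theorems.RootDecomp1FPresentable

open Summit.Schanuel.Schanuel.Theses.RootDecomp1F

/-- Item stmt-Schanuel-26229 (`Presentable`, support r9 of route-Schanuel-RootDecomp1F): every first failure
is a non-degenerate Khovanskii point of some size `c`. -/
theorem presentable_holds : Presentable := by
  classical
  intro n x hx
  obtain ⟨g, hg0, hdet⟩ :=
    Summit.Schanuel.Schanuel.Theorems.MinimalCounterexampleInAcl.Negative.firstFailure_khovanskii hx.2.1 hx.2.2 hx.1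
  exact ⟨Finset.univ.sup fun i => max (g i).totalDegree
      ((g i).support.sup fun m => max ((g i).coeff m).num.natAbs ((g i).coeff m).den), g,
    fun i => Finset.le_sup (f := fun i => max (g i).totalDegree
      ((g i).support.sup fun m => max ((g i).coeff m).num.natAbs ((g i).coeff m).den)) (Finset.mem_univ i),
    hg0, hdet⟩

end Summit.Schanuel.Schanuel.Theorems.RootDecomp1FPresentable

end
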